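/-
Origin: expansion seat `planner-pub-hodgecm-toy2-g5-0`, handover #14 2026-08-18T10:08:51Z (`HOME/pub-hodgecm-toy2-g5/lean/Toy2g5/ToyPadH0JPohlmann.lean`, md5 b0fdc85f, 249 lines);
landed by the gen-7 packager in gate run 28 as `HodgeCM/Model/Toy/ToyPadH0JPohlmann.lean` (stripped 6 #print/#check/#eval lines).
-/
/-
Copyright (c) 2026. All rights reserved.
Released under Apache 2.0 license as described in the file LICENSE.
Origin: CONSISTENCY seat 2 (6a)(ii) `planner-pub-hodgecm-toy2-g5-0` (unit pub-hodgecm-toy2-g5), handover #14 (RUN 28).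
WIP module `Toy2g5.ToyPadH0JPohlmann`; intended final place `HodgeCM/Model/Toy/ToyPadH0JPohlmann.lean`
(module `HodgeCM.Model.Toy.ToyPadH0JPohlmann`).  ADDITIVE LEAF over RUN-27 tree files only (`HodgeCM.Model.Toy.ToyPadH0J`,
`HodgeCM.Proofs.Pohlmann.AnyCMFieldNoN4`) and older tree files; NO import to rewrite; replaces nothing; nothing imports it.
Suggested by `planner-pub-hodgecm-qw8b-g5-0` (STATUS 2026-08-18T10:02:59Z).
-/
import Summits.HodgeConjecture.HodgeCM.Model.Toy.ToyPadH0J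
import Summits.HodgeConjecture.HodgeCM.Model.Inhabited
import Summits.HodgeConjecture.HodgeCM.Proofs.Pohlmann.DegreeZeroIff
import Summits.HodgeConjecture.HodgeCM.Proofs.Pohlmann.AnyCMFieldNoN4

/-!
# N4 is NECESSARY for "Thm 3.1 at every `p ≥ 0` ⇒ connectedness": the kernel witness `toyModel♭ᴶ`

`HodgeCM.Universe.cmProdConnectedGalois_of_pohlmannTheorem31All (hN4 : U.Fact_hodge_F0) :
U.PohlmannTheorem31All → U.CMProdConnectedGalois` (pohl-g8, `DegreeZeroIff`) uses N4.  This file shows that N4 cannot be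
dropped there, even in the presence of `ModelAxioms`, N1, N2, N3 (and F4, F5, M40, `W_RK4`, `PohlmannSpan`, `HC_CM`):
the slope-pair padded universe `U♭ᴶ = U.padH0 U.padDatumJ` (toy2-g5, `HodgeCM.Model.PadH0J`) of a model `U` of
`ModelAxioms ∧ N1–N4 ∧ M40 ∧ CMProdConnectedGalois` satisfies Gao–Ullmo Thm 3.1 for EVERY `p ≥ 0`
(`PadH0J.pohlmannTheorem31All`) — at `p ≥ 1` because `U♭ᴶ ⊨ ModelAxioms ∧ N1 ∧ N2 ∧ N3` (`pohlmannTheorem31_of_facts₃`,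
qw8b/pohl `AnyCMFieldNoN4`), at `p = 0` because its rational Hodge classes of degree `0` are exactly the line `H⁰(A′, ℚ)`
of `U` (the pad, of Hodge types `(1,−1) + (−1,1)`, carries no rational Hodge class: `SlopePad.jStructure_hodgeClasses_zero`)
— while its `H⁰(A′, ℚ)` has rank `3`, so `CMProdConnectedGalois`, `CMProdConnected` and M42 `Fact_H0_rank` FAIL in it.

Headlines (namespace `HodgeCM.Toy`): `jPadModel_pohlmannTheorem31All`, `not_jPadModel_cmProdConnectedGalois`,
`fact_hodge_F0_necessary : ¬ ∀ U, ModelAxioms → N1 → N2 → N3 → PohlmannTheorem31All → CMProdConnectedGalois`,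
`pohlmannTheorem31All_connected_independent` (both truth values of `CMProdConnectedGalois` under
`ModelAxioms ∧ N1 ∧ N2 ∧ N3 ∧ PohlmannTheorem31All`), and for the EQUALITY form: `not_jPadModel_pohlmannBasis`,
`fact_hodge_F0_necessary_basis : ¬ ∀ U, ModelAxioms → N1 → N2 → N3 → PohlmannBasis` (N4 necessary in `pohlmannBasis_of_facts`;
the `p = 0` residue `B⁰ ⊗ ℂ = H⁰(A′, ℂ)`).  Generic part (namespace `HodgeCM.Universe.PadH0` / `PadH0J`):
`PadH0.hodgeClassesOfEquiv` (`B^p` of `U♭` is `B^p` of `U` when the pad has no rational Hodge class),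
`PadH0J.finrank_coh_zero` (`dim H⁰` triples), `PadH0J.pohlmannTheorem31All`, `PadH0J.not_cmProdConnectedGalois`.
Nothing is cited; Lean + Mathlib axioms only.
-/

noncomputable section

open scoped TensorProduct

namespace HodgeCM

open Literature.AlgebraicGeometry.Motives (CMType HodgeStructure)

namespace Universe

namespace PadH0

variable {U : Universe} {D : U.PadDatum}

/-- When the pad structures carry no rational Hodge class of level `0`, the rational Hodge classes `B^p(X)` of `U♭ = U.padH0 D`
ARE those of `U` (in the geometric summand): the linear equivalence induced by `toU` / `ofU`. -/
def hodgeClassesOfEquiv (hP : ∀ X : U.Var, (D.hs X).hodgeClasses 0 = ⊥) (X : U.Var) (p : ℕ) :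
    ↥((U.padH0 D).hodgeClassesOf X p) ≃ₗ[ℚ] ↥(U.hodgeClassesOf X p) where
  toFun x := ⟨toU D X (2 * p) x.1, ((mem_hodgeClassesOf_iff_of_padHodge hP X p x.1).1 x.2).1⟩
  invFun v := ⟨ofU D X (2 * p) v.1,
    (mem_hodgeClassesOf_iff_of_padHodge hP X p _).2 ⟨by rw [toU_ofU]; exact v.2, padOf_ofU X (2 * p) v.1⟩⟩
  map_add' x y := Subtype.ext (map_add (toU D X (2 * p)) x.1 y.1)
  map_smul' c x := Subtype.ext (LinearMap.map_smul (toU D X (2 * p)) c x.1)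
  left_inv x := Subtype.ext (by
    have h0 : padOf D X (2 * p) x.1 = 0 := ((mem_hodgeClassesOf_iff_of_padHodge hP X p x.1).1 x.2).2
    have h := ofU_toU_add (D := D) X (2 * p) x.1
    rw [h0, map_zero, add_zero] at h
    exact h)
  right_inv v := Subtype.ext (toU_ofU (D := D) X (2 * p) v.1)

/-- … hence `dim_ℚ B^p(X)` is the same in `U♭` and in `U`. -/
theorem finrank_hodgeClassesOf_of_padHodge (hP : ∀ X : U.Var, (D.hs X).hodgeClasses 0 = ⊥) (X : U.Var) (p : ℕ) :
    Module.finrank ℚ ↥((U.padH0 D).hodgeClassesOf X p) = Module.finrank ℚ ↥(U.hodgeClassesOf X p) :=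
  (hodgeClassesOfEquiv hP X p).finrank_eq

end PadH0

namespace PadH0J

variable {U : Universe}

/-- `dim_ℚ B^p(X)` in `U♭ᴶ` equals `dim_ℚ B^p(X)` in `U` (the slope-pair pad has no rational Hodge class). -/
theorem finrank_hodgeClassesOf (X : U.Var) (p : ℕ) :
    Module.finrank ℚ ↥((U.padH0 U.padDatumJ).hodgeClassesOf X p) = Module.finrank ℚ ↥(U.hodgeClassesOf X p) :=
  PadH0.finrank_hodgeClassesOf_of_padHodge (fun _ => SlopePad.jStructure_hodgeClasses_zero _) X p

/-- In degree `0`: `dim_ℚ B⁰(X)` in `U♭ᴶ` is `dim_ℚ H⁰(X, ℚ)` of `U` when `U ⊨ N4`. -/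
theorem finrank_hodgeClassesOf_zero (hN4 : U.Fact_hodge_F0) (X : U.Var) :
    Module.finrank ℚ ↥((U.padH0 U.padDatumJ).hodgeClassesOf X 0) = Module.finrank ℚ (U.Coh X 0) := by
  rw [finrank_hodgeClassesOf, hodgeClassesOf_zero_eq_top hN4, finrank_top]

/-- `dim_ℚ H⁰(X, ℚ)` TRIPLES in `U♭ᴶ` (`H⁰ ⊕ (H⁰ × H⁰)`). -/
theorem finrank_coh_zero (X : U.Var) :
    Module.finrank ℚ ((U.padH0 U.padDatumJ).Coh X 0) = 3 * Module.finrank ℚ (U.Coh X 0) := by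
  show Module.finrank ℚ (U.Coh X 0 × (U.Coh X 0 × U.Coh X 0)) = _
  rw [Module.finrank_prod, Module.finrank_prod]
  ring

variable {F : CMField} {n : ℕ}

/-- **Gao–Ullmo Thm 3.1 for EVERY `p ≥ 0` holds in `U♭ᴶ`** whenever `U ⊨ ModelAxioms ∧ M40 ∧ N1 ∧ N2 ∧ N3 ∧ N4 ∧
CMProdConnectedGalois`: at `p ≥ 1` from `ModelAxioms ∧ N1 ∧ N2 ∧ N3` of `U♭ᴶ` (`pohlmannTheorem31_of_facts₃`); at `p = 0`
because `B⁰(A′)` of `U♭ᴶ` is the line `H⁰(A′, ℚ)` of `U` and every degree-`0` class has the empty weight (N3). -/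
theorem pohlmannTheorem31All (M : U.ModelAxioms) (hd : U.Fact_dimProd) (hN1 : U.Fact_cupExterior)
    (hN2 : U.Fact_cup_hodge) (hN3 : U.Fact_pull_H0) (hN4 : U.Fact_hodge_F0) (h0 : U.CMProdConnectedGalois) :
    (U.padH0 U.padDatumJ).PohlmannTheorem31All := by
  intro F hG n Θ p
  haveI := hG
  rcases Nat.eq_zero_or_pos p with rfl | hp
  · have hB : Module.finrank ℚ ↥((U.padH0 U.padDatumJ).hodgeClassesOf ((U.padH0 U.padDatumJ).cmProd F Θ) 0) = 1 := by
      rw [PadH0.cmProd_eq, finrank_hodgeClassesOf_zero hN4]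
      exact h0 F hG n Θ
    refine ⟨?_, by rw [card_isHodgeWeight_zero]; exact hB⟩
    have hfin : Module.finrank ℂ
        ↥(((U.padH0 U.padDatumJ).hodgeClassesOf ((U.padH0 U.padDatumJ).cmProd F Θ) 0).baseChange ℂ) = 1 := by
      rw [← (Submodule.toBaseChange.toLinearEquiv ℂ
        ((U.padH0 U.padDatumJ).hodgeClassesOf ((U.padH0 U.padDatumJ).cmProd F Θ) 0)).finrank_eq,
        Module.finrank_baseChange, hB]
    haveI : Module.Finite ℂ
        ↥(((U.padH0 U.padDatumJ).hodgeClassesOf ((U.padH0 U.padDatumJ).cmProd F Θ) 0).baseChange ℂ) :=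
      Module.finite_of_finrank_eq_succ hfin
    haveI : Unique {S : Fin (n + 1) → Finset ((F : Type) →+* ℂ) // IsHodgeWeight Θ 0 S} :=
      { default := ⟨fun _ => ∅, (isHodgeWeight_zero_iff _).2 rfl⟩
        uniq := fun a => Subtype.ext ((isHodgeWeight_zero_iff a.1).1 a.2) }
    refine ⟨(Module.finBasisOfFinrankEq ℂ _ hfin).reindex (Equiv.ofUnique _ _), fun S => ?_⟩
    have hS : S.1 = fun _ => ∅ := (isHodgeWeight_zero_iff S.1).1 S.2
    rw [mem_weightSpace_iff, hS]
    exact isWeightVector_zero (PadH0J.fact_pull_H0 hN3) _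
  · exact pohlmannTheorem31_of_facts₃ (PadH0J.modelAxioms M hd) (PadH0.fact_cupExterior_iff.mpr hN1)
      (PadH0.fact_cup_hodge hN2) (PadH0J.fact_pull_H0 hN3) F hG n Θ p hp

/-- **… while the Galois CM products of `U♭ᴶ` are NOT connected** (`dim_ℚ H⁰ = 3 · dim_ℚ H⁰ ≠ 1`), as soon as one of them has
`H⁰ ≠ 0` in `U`. -/
theorem not_cmProdConnectedGalois (F : CMField) (hG : IsGalois ℚ F) (Θ : Fin (n + 1) → CMType F)
    [Nontrivial (U.Coh (U.cmProd F Θ) 0)] : ¬ (U.padH0 U.padDatumJ).CMProdConnectedGalois := fun h => by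
  have h1 := h F hG n Θ
  rw [PadH0.cmProd_eq, finrank_coh_zero] at h1
  have h2 : 0 < Module.finrank ℚ (U.Coh (U.cmProd F Θ) 0) := Module.finrank_pos
  omega

/-- **… and the EQUALITY form `PohlmannBasis` (`B^p ⊗ ℂ = ⨆_S V_S`; at `p = 0`: `B⁰ ⊗ ℂ = V_∅ = H⁰(A′, ℂ)`) FAILS in `U♭ᴶ`**
— the left side is a line, the right side has dimension `3 · dim_ℚ H⁰(A′, ℚ)` — as soon as `U ⊨ N3 ∧ N4` and one Galois CM product
is connected in `U`.  So N4 is necessary in `pohlmannBasis_of_facts` as well (the `p = 0` residue of N4 on the Pohlmann row). -/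
theorem not_pohlmannBasis (hN3 : U.Fact_pull_H0) (hN4 : U.Fact_hodge_F0) (F : CMField) (hG : IsGalois ℚ F)
    (Θ : Fin (n + 1) → CMType F) (h1 : Module.finrank ℚ (U.Coh (U.cmProd F Θ) 0) = 1) :
    ¬ (U.padH0 U.padDatumJ).PohlmannBasis := fun h => by
  have hp := h F hG n Θ 0
  have htop : (⨆ (S : Fin (n + 1) → Finset ((F : Type) →+* ℂ)) (_ : IsHodgeWeight Θ 0 S),
      (U.padH0 U.padDatumJ).weightSpace F Θ S (2 * 0)) = ⊤ :=
    eq_top_iff.2 fun y _ =>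
      Submodule.mem_iSup_of_mem (fun _ => ∅) (Submodule.mem_iSup_of_mem ((isHodgeWeight_zero_iff _).2 rfl)
        ((mem_weightSpace_iff _ _ _ _ _).2 (isWeightVector_zero (PadH0J.fact_pull_H0 hN3) y)))
  have hL : Module.finrank ℂ
      ↥(((U.padH0 U.padDatumJ).hodgeClassesOf ((U.padH0 U.padDatumJ).cmProd F Θ) 0).baseChange ℂ) =
        Module.finrank ℚ ↥((U.padH0 U.padDatumJ).hodgeClassesOf ((U.padH0 U.padDatumJ).cmProd F Θ) 0) := by
    rw [← (Submodule.toBaseChange.toLinearEquiv ℂ _).finrank_eq, Module.finrank_baseChange]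
  have h20 : Module.finrank ℚ ((U.padH0 U.padDatumJ).Coh (U.cmProd F Θ) (2 * 0)) =
      Module.finrank ℚ ((U.padH0 U.padDatumJ).Coh (U.cmProd F Θ) 0) := rfl
  rw [hp, htop, finrank_top, Module.finrank_baseChange, PadH0.cmProd_eq, h20, finrank_hodgeClassesOf_zero hN4,
    finrank_coh_zero, h1] at hL
  omega

end PadH0J

end Universe

namespace Toy

open Universe

/-- **`toyModel♭ᴶ ⊨` Gao–Ullmo Thm 3.1 for every `p ≥ 0`.** -/
theorem jPadModel_pohlmannTheorem31All : jPadModel.PohlmannTheorem31All :=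
  PadH0J.pohlmannTheorem31All toyModel_modelAxioms toyModel_fact_dimProd toyModel_fact_cupExterior
    toyModel_fact_cup_hodge toyModel_fact_pull_H0 toyModel_fact_hodge_F0
    (cmProdConnectedGalois_of_H0_rank toyModel_fact_H0_rank)

/-- **`toyModel♭ᴶ ⊭ CMProdConnectedGalois`** (`H⁰(A_{(ℚ(ζ₇),Φ)}, ℚ)` has rank `3`). -/
theorem not_jPadModel_cmProdConnectedGalois : ¬ jPadModel.CMProdConnectedGalois :=
  haveI : Nontrivial (toyModel.Coh (toyModel.cmProd cyclo7 (fun _ : Fin (0 + 1) => stdCMType cyclo7)) 0) :=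
    cmProdH0Nontrivial exteriorHodgeData cyclo7 0 _
  PadH0J.not_cmProdConnectedGalois (U := toyModel) cyclo7 cyclo7_isGalois (fun _ : Fin (0 + 1) => stdCMType cyclo7)

/-- **`toyModel♭ᴶ ⊭ PohlmannBasis`** (the `p = 0` equality `B⁰ ⊗ ℂ = H⁰(A′, ℂ)` fails: `1 ≠ 3`). -/
theorem not_jPadModel_pohlmannBasis : ¬ jPadModel.PohlmannBasis :=
  PadH0J.not_pohlmannBasis (U := toyModel) toyModel_fact_pull_H0 toyModel_fact_hodge_F0 cyclo7 cyclo7_isGalois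
    (fun _ : Fin (0 + 1) => stdCMType cyclo7) (toyModel_fact_H0_rank _)

/-- **N4 is NECESSARY in `pohlmannBasis_of_facts`**: `PohlmannBasis` does not follow from `ModelAxioms ∧ N1 ∧ N2 ∧ N3`. -/
theorem fact_hodge_F0_necessary_basis :
    ¬ ∀ U : Universe, U.ModelAxioms → U.Fact_cupExterior → U.Fact_cup_hodge → U.Fact_pull_H0 → U.PohlmannBasis :=
  fun h => not_jPadModel_pohlmannBasis (h jPadModel jPadModel_modelAxioms jPadModel_fact_cupExterior
    jPadModel_fact_cup_hodge jPadModel_fact_pull_H0)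

/-- (Ported verbatim from the HodgeCMPerL package; no docstring in the source.) -/
theorem not_jPadModel_cmProdConnected : ¬ jPadModel.CMProdConnected :=
  fun h => not_jPadModel_cmProdConnectedGalois (cmProdConnectedGalois_of_connected h)

/-- M42 `Fact_H0_rank` fails in `toyModel♭ᴶ`. -/
theorem not_jPadModel_fact_H0_rank : ¬ jPadModel.Fact_H0_rank :=
  fun h => not_jPadModel_cmProdConnectedGalois (cmProdConnectedGalois_of_H0_rank h)

/-- **N4 `Fact_hodge_F0` is NECESSARY in `cmProdConnectedGalois_of_pohlmannTheorem31All` / the (→) of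
`pohlmannTheorem31All_iff`**: Thm 3.1 at every `p ≥ 0` does NOT imply connectedness of the Galois CM products over
`ModelAxioms ∧ N1 ∧ N2 ∧ N3` (witness `toyModel♭ᴶ`). -/
theorem fact_hodge_F0_necessary :
    ¬ ∀ U : Universe, U.ModelAxioms → U.Fact_cupExterior → U.Fact_cup_hodge → U.Fact_pull_H0 →
      U.PohlmannTheorem31All → U.CMProdConnectedGalois :=
  fun h => not_jPadModel_cmProdConnectedGalois (h jPadModel jPadModel_modelAxioms jPadModel_fact_cupExterior
    jPadModel_fact_cup_hodge jPadModel_fact_pull_H0 jPadModel_pohlmannTheorem31All)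

/-- The same with the whole positive profile of `toyModel♭ᴶ` as hypotheses (F4, F5, M40, `W_RK4`, `PohlmannSpan`, `HC_CM`). -/
theorem fact_hodge_F0_necessary' :
    ¬ ∀ U : Universe, U.ModelAxioms → U.Fact_cupExterior → U.Fact_cup_hodge → U.Fact_pull_H0 → U.Fact_cupAlg →
      U.Fact_cupAssoc → U.Fact_dimProd → U.W_RK4 → U.PohlmannSpan → U.HC_CM → U.PohlmannTheorem31All →
      U.CMProdConnectedGalois :=
  fun h => not_jPadModel_cmProdConnectedGalois (h jPadModel jPadModel_modelAxioms jPadModel_fact_cupExterior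
    jPadModel_fact_cup_hodge jPadModel_fact_pull_H0 jPadModel_fact_cupAlg jPadModel_fact_cupAssoc jPadModel_fact_dimProd
    jPadModel_w_rk4 jPadModel_pohlmannSpan jPadModel_hc_cm jPadModel_pohlmannTheorem31All)

/-- **Independence form**: over `ModelAxioms ∧ N1 ∧ N2 ∧ N3 ∧ PohlmannTheorem31All`, connectedness of the Galois CM products
takes both truth values (`toyModel`: true; `toyModel♭ᴶ`: false). -/
theorem pohlmannTheorem31All_connected_independent :
    (∃ U : Universe, (U.ModelAxioms ∧ U.Fact_cupExterior ∧ U.Fact_cup_hodge ∧ U.Fact_pull_H0 ∧ U.PohlmannTheorem31All) ∧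
      U.CMProdConnectedGalois) ∧
    (∃ U : Universe, (U.ModelAxioms ∧ U.Fact_cupExterior ∧ U.Fact_cup_hodge ∧ U.Fact_pull_H0 ∧ U.PohlmannTheorem31All) ∧
      ¬ U.CMProdConnectedGalois) :=
  ⟨⟨toyModel, ⟨toyModel_modelAxioms, toyModel_fact_cupExterior, toyModel_fact_cup_hodge, toyModel_fact_pull_H0,
      pohlmannTheorem31All_of_connected toyModel_modelAxioms toyModel_fact_cupExterior toyModel_fact_cup_hodge
        toyModel_fact_pull_H0 toyModel_fact_hodge_F0 (cmProdConnected_of_H0_rank toyModel_fact_H0_rank)⟩,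
      cmProdConnectedGalois_of_H0_rank toyModel_fact_H0_rank⟩,
    ⟨jPadModel, ⟨jPadModel_modelAxioms, jPadModel_fact_cupExterior, jPadModel_fact_cup_hodge, jPadModel_fact_pull_H0,
      jPadModel_pohlmannTheorem31All⟩, not_jPadModel_cmProdConnectedGalois⟩⟩

/-- … and `PohlmannTheorem31All` does not give back N4 either (over `ModelAxioms ∧ N1 ∧ N2 ∧ N3`). -/
theorem not_fact_hodge_F0_of_pohlmannTheorem31All :
    ¬ ∀ U : Universe, U.ModelAxioms → U.Fact_cupExterior → U.Fact_cup_hodge → U.Fact_pull_H0 →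
      U.PohlmannTheorem31All → U.Fact_hodge_F0 :=
  fun h => not_jPadModel_fact_hodge_F0 (h jPadModel jPadModel_modelAxioms jPadModel_fact_cupExterior
    jPadModel_fact_cup_hodge jPadModel_fact_pull_H0 jPadModel_pohlmannTheorem31All)

end Toy

end HodgeCM

end

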